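/-
Copyright (c) 2026 the pub-hodgecm-mathlib formalisation cell (harness21).  Prover seat hodgecm-mathlib-F0P2-p02 (g10), programme P2 — pen for the absent P2 desk
(LEAD F0P3a-plan (g10) WORD T9-24 (2) ∕ T9-34 (3) «p02 pens P2»), 2026-09-01.  KERNEL module: ONE THEOREM (no definition, no named fact, no `sorry`, no instance, no notation).
-/
import Literature.NumberTheory.Automorphic.Liu2021.Def412AdmissibleIffParity        -- (E1 ∕ OCC♭-GEN vocabulary) admissibility
import Literature.AlgebraicGeometry.Liu2021.AdmissibleElement                       -- `IsAdmissibleElement`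
import Literature.NumberTheory.QuadraticForms.PrescribedNormClassesCM               -- (E1 import)
import Literature.NumberTheory.Rogawski1990.CohomologicalFinComponentIsTheta        -- the (C♭)-telescope vocabulary (`rhoAtLine` frame data, `locF`, `epsOf`, …)
import Summits.HodgeConjecture.CorCM.B01.Transposition.Item6OmegaChiSplitting      -- `isCompatible_chiSplittingLine`
import Summits.HodgeConjecture.HodgeConjecture.Theorems.F0P2OccGenCotangentOfOccursIn -- ★ p844131 F0P2-p06 (g8) B1′: frame packaging + `exists_cotangentType_hasFinComponent_of_occursIn_cm`
import Summits.HodgeConjecture.HodgeConjecture.Theorems.F0P2cStubCI                 -- ★ `rhoAtLine_chi_isIrreducible` (general frame, [Liu2021, Lem. D.1])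
import HarnessLib

/-!
# FLOOR-0 P2 · «OCC♭∀ ⟸ Θ-OCC-GEN» AT THEOREMS LEVEL — the concluder of the OCC♭-GEN sub-line, importable by any module (E1 ED. 3 «one-token cut»)

Cell hodgecm-mathlib (D-0151), FLOOR 0; crux item H413 = stmt-HodgeConjecture-24833 (route `HCCMUnconditional`); programme P2, socket 27455 `F0HdictE`, road II′
(E3♭ ⟸ {REL¹, OCC♭∀}).  `--supports stmt-HodgeConjecture-24833`.  HONEST LABEL: HC_CM is proved only modulo the printed citations until rung 0 closes; this file
closes NO print letter: it is the sub-line concluder ★ `Cruxes/H413/Lines/F0_P2OccFlatGeneral.lean :: occTarget_of_thetaOccursIn` (desk F0P2-plan (g12), ED. 1 v2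
d4b61ff8c7817f4a) RE-HOMED under `Theorems/`, so that the parent Lines file E1 `Cruxes/H413/Lines/F0_P2E3RelSign.lean` can CONSUME it by import — a Lines file never
imports a Lines file (ref1 O50-1), but it imports Theorems files.

## What is proved
**`stubOccFlatAll_of_thetaOccursInGen (hΘ : ‹Θ-OCC-GEN›) : ‹OCC♭∀›`** — hypothesis = the body of `F0P2OccFlatGeneral.StubThetaOccursInGen` (ED. 1 v2 :248–284, pasted
token for token; ws-sha16 b50e296e47edd31f): at every CM frame `(L, ι, H, T)` of signature `(2,1)` at `ι`, definite elsewhere, `[L⁺:ℚ] ≥ 2`, every diagonal frame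
`(e₁, dV, g, ιV)`, every weight-one conjugate-symplectic `μ`, every `μ`-admissible line `⟨a⟩` and every `χ`, the oscillator representation `ρ(a,χ)` OCCURS (non-zero
`ρ(a,χ)`-equivariant `ℂ`-linear map) in the cohomological cotangent forms of `U(H)`; conclusion = the body of `F0P2E3RelSign.StubOccFlatAdmissibleAll` (E1 ED. 2 «ONE MEASURE»
55d99f43644bf3ac :241–268 = OCC♭-GEN's `OccTarget`, pasted token for token; ws-sha16 70c2a2a489da080c): for EVERY automorphic measure `μA`, a discrete automorphic `P ≤ L²(μA)` of
(anti)holomorphic cotangent type at the frame with `P.HasFinComponent ρ(a,χ)`.  PROOF = the sub-line's §4 VERBATIM: `ρ(a,χ)` is irreducible at the general frame (★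
`F0P2cStubCI.rhoAtLine_chi_isIrreducible`, [Liu2021, Lem. D.1]) and the general-frame, GIVEN-MEASURE pin assembly ★ `exists_cotangentType_hasFinComponent_of_occursIn_cm`
(p844131; J1′ ★ + (D)∕(D̄) ★ + projection ★) yields `P`.  The two junctions `‹hypothesis› ↔ F0P2OccFlatGeneral.StubThetaOccursInGen` and `‹conclusion› ↔
F0P2E3RelSign.StubOccFlatAdmissibleAll` are `Iff.rfl` over the Lines oleans (referee's cert; this file imports neither).

## References
* [Liu2021] Y. Liu, *Fourier–Jacobi cycles and arithmetic relative trace formula*, Camb. J. Math. 9 (2021) = arXiv:2102.11518: Prop. 4.13 (proof l. 2121–2146, «Conversely» l. 2145), Rem. 4.14 (l. 2148–2150), Def. 4.12, App. D Lem. D.1 (l. 5226 ff.) ∕ D.2.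
* [GelbartRogawski1991] S. Gelbart, J. Rogawski, *L-functions and Fourier–Jacobi coefficients for the unitary group U(3)*, Invent. Math. 105 (1991): §3.1 Prop. 3.1.1.
* [BorelJacquet1979] A. Borel, H. Jacquet, PSPM 33.1 (1979): §4.2, §4.6.
-/

set_option autoImplicit false

-- the mandated namespace has the single-problem summit's repeated segment (`HodgeConjecture.HodgeConjecture`)
set_option linter.dupNamespace false

noncomputable section

namespace Summit.HodgeConjecture.HodgeConjecture.Cruxes.H413.F0P2sOccFlatAllOfThetaOccursIn

open scoped TensorProduct Matrix InnerProductSpace ENNReal ComplexOrder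
open MeasureTheory
open NumberField NumberField.InfinitePlace IsDedekindDomain
open Literature.NumberTheory Literature.NumberTheory.Automorphic Literature.NumberTheory.Automorphic.UnitaryGroup
open Literature.NumberTheory.Automorphic.UnitaryGroup.CotangentForms (cmArchSection cmCompactFactor)
open Literature.NumberTheory.Automorphic.Liu2021 Literature.NumberTheory.Automorphic.Liu2021.AppendixC
open Literature.NumberTheory.Automorphic.Liu2021.Def411WeilCarriers
open Literature.NumberTheory.Automorphic.Liu2021.Def411WeilCarriersDoubling
open Literature.NumberTheory.Automorphic.IdeleClassGroup
open Literature.NumberTheory.GelbartRogawski1991 Literature.NumberTheory.GelbartRogawski1991.UnitaryDualPair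
open Literature.NumberTheory.GelbartRogawski1991.UnitaryDualPair.WeilCoinv
open Literature.RepresentationTheory Literature.RepresentationTheory.Liu2021
open Literature.NumberTheory.Rogawski1990
open Literature.NumberTheory.QuadraticForms
open Literature.AlgebraicGeometry.Liu2021 (IsAdmissibleElement)
open Summit.HodgeConjecture.CorCM
open Summit.HodgeConjecture.CorCM.Transposition
open Summit.HodgeConjecture.HodgeConjecture.Cruxes.H413.F0P2OccGenCotangentOfOccursIn (exists_cotangentType_hasFinComponent_of_occursIn_cm)

set_option synthInstance.maxHeartbeats 400000 in
set_option maxHeartbeats 8000000 in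
/-- **OCC♭∀ ⟸ Θ-OCC-GEN, at Theorems level** (the OCC♭-GEN sub-line's `occTarget_of_thetaOccursIn`, importable): hypothesis = Θ-OCC-GEN's text, conclusion = OCC♭∀'s text
(both token for token).  At the given frame and the GIVEN automorphic measure `μA`: `ρ(a,χ)` is irreducible (★ `F0P2cStubCI.rhoAtLine_chi_isIrreducible`) and the
general-frame pin assembly ★ `exists_cotangentType_hasFinComponent_of_occursIn_cm` turns the letter's non-zero equivariant `θ` into a discrete automorphic `P ≤ L²(μA)` of
(anti)holomorphic cotangent type with `P.HasFinComponent ρ(a,χ)`. [cite: Liu2021, Prop. 4.13 (proof l. 2121–2146); App. D Lem. D.1] [cite: GelbartRogawski1991, Prop. 3.1.1]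
[cite: BorelJacquet1979, §4.2, §4.6] -/
theorem stubOccFlatAll_of_thetaOccursInGen
    (hΘ :
      ∀ (L : Type) [Field L] [NumberField L] [IsCMField L] (ι : L →+* ℂ) (H : Matrix (Fin 3) (Fin 3) L) (T : GL (Fin 3) ℂ)
      (hT : (T : Matrix (Fin 3) (Fin 3) ℂ)ᴴ * H.map ι * (T : Matrix (Fin 3) (Fin 3) ℂ) = Literature.Geometry.ComplexHyperbolic.BallModel.J),
      (∀ τ' : L →+* ℂ, InfinitePlace.mk τ' ≠ InfinitePlace.mk ι → (H.map τ').PosDef) → 2 ≤ Module.finrank ℚ ↥(maximalRealSubfield L) →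
      ∀ {n' : ℕ} (e₁ : Fin 3 × Fin 1 ≃ Fin n') (dV : Fin 3 → L) (hdV : ∀ i, IsCMField.complexConj L (dV i) = dV i)
      (hdV0 : ∀ i, dV i ≠ 0) (g : GL (Fin 3) L)
      (hg : ((g : Matrix (Fin 3) (Fin 3) L).map (cmConjRingHom L))ᵀ * H * (g : Matrix (Fin 3) (Fin 3) L) = Matrix.diagonal dV)
      (ιV : finAdelic (↥(maximalRealSubfield L)) L (IsCMField.complexConj L) 3 H →*
      finAdelic (↥(maximalRealSubfield L)) L (IsCMField.complexConj L) 3 (Matrix.diagonal dV)),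
      (∀ k, ((ιV k : finAdelic (↥(maximalRealSubfield L)) L (IsCMField.complexConj L) 3 (Matrix.diagonal dV)) :
      GL (Fin 3) (FiniteAdeleRing (𝓞 L) L)) =
      (toFinAdeleGL L 3 g)⁻¹ * (k : GL (Fin 3) (FiniteAdeleRing (𝓞 L) L)) * toFinAdeleGL L 3 g) →
      ∀ (μ : Literature.NumberTheory.Automorphic.IdeleClassGroup L →ₜ* Circle) (hμ : IsConjugateSymplectic L μ), HasWeight L μ 1 →
      ∀ (a : (↥(maximalRealSubfield L))ˣ) (χ : Chi (↥(maximalRealSubfield L)) L (IsCMField.complexConj L)),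
      (∃ e : L, IsAdmissibleElement L hμ.cmType.1 e ∧
      epsOf (↥(maximalRealSubfield L)) (imagUnitSq L) L (2 * imagUnit L)⁻¹ e = locF (↥(maximalRealSubfield L)) (imagUnitSq L) a) →
      ∃ θ : (omegaAtLine (↥(maximalRealSubfield L)) L (IsCMField.complexConj L) 3 e₁ (Matrix.diagonal dV)
      (complexConj_imagUnit L) (imagUnit_ne_zero L) (imagUnit_mul_self L) (realDiagonal_isSymm L dV hdV)
      (isUnit_det_realDiagonal L dV hdV hdV0) (realDiagonal_map L dV hdV).symm
      (fun a => isCompatible_chiSplittingLine L e₁ dV hdV hdV0 (toHeckeCharacter L μ)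
      (isUnitary_toHeckeCharacter L μ) ((isOscillatorChar_toHeckeCharacter_iff μ).mpr hμ)
      (TW (↥(maximalRealSubfield L)) a) (isSymm_TW (↥(maximalRealSubfield L)) a)
      (isUnit_det_TW (↥(maximalRealSubfield L)) a) (JW (↥(maximalRealSubfield L)) L a)
      (JW_eq (↥(maximalRealSubfield L)) L a)) a χ) →ₗ[ℂ]
      ((adelicGroupData (↥(maximalRealSubfield L)) L (IsCMField.complexConj L) 3 H).Adelic → (Fin 2 → ℂ)),
      θ ≠ 0 ∧
      (∀ w, θ w ∈ CotangentForms.cohForms (↥(maximalRealSubfield L)) L (IsCMField.complexConj L) 3 H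
      (cmArchSection L ι H T hT) (cmCompactFactor L ι H T hT)) ∧
      ∀ (k : ↥(finAdelic (↥(maximalRealSubfield L)) L (IsCMField.complexConj L) 3 H)) w,
      θ (rhoAtLine (↥(maximalRealSubfield L)) L (IsCMField.complexConj L) 3 e₁ (Matrix.diagonal dV)
      (complexConj_imagUnit L) (imagUnit_ne_zero L) (imagUnit_mul_self L) (realDiagonal_isSymm L dV hdV)
      (isUnit_det_realDiagonal L dV hdV hdV0) (realDiagonal_map L dV hdV).symm
      (fun a => isCompatible_chiSplittingLine L e₁ dV hdV hdV0 (toHeckeCharacter L μ)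
      (isUnitary_toHeckeCharacter L μ) ((isOscillatorChar_toHeckeCharacter_iff μ).mpr hμ)
      (TW (↥(maximalRealSubfield L)) a) (isSymm_TW (↥(maximalRealSubfield L)) a)
      (isUnit_det_TW (↥(maximalRealSubfield L)) a) (JW (↥(maximalRealSubfield L)) L a)
      (JW_eq (↥(maximalRealSubfield L)) L a)) ιV a χ k w) =
      fun x => θ w (x * finAdelicToAdelic (↥(maximalRealSubfield L)) L (IsCMField.complexConj L) 3 H k)) :
    ∀ (L : Type) [Field L] [NumberField L] [IsCMField L] (ι : L →+* ℂ) (H : Matrix (Fin 3) (Fin 3) L) (T : GL (Fin 3) ℂ)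
    (hT : (T : Matrix (Fin 3) (Fin 3) ℂ)ᴴ * H.map ι * (T : Matrix (Fin 3) (Fin 3) ℂ) = Literature.Geometry.ComplexHyperbolic.BallModel.J),
    (∀ τ' : L →+* ℂ, InfinitePlace.mk τ' ≠ InfinitePlace.mk ι → (H.map τ').PosDef) → 2 ≤ Module.finrank ℚ ↥(maximalRealSubfield L) →
    ∀ {n' : ℕ} (e₁ : Fin 3 × Fin 1 ≃ Fin n') (dV : Fin 3 → L) (hdV : ∀ i, IsCMField.complexConj L (dV i) = dV i)
    (hdV0 : ∀ i, dV i ≠ 0) (g : GL (Fin 3) L)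
    (hg : ((g : Matrix (Fin 3) (Fin 3) L).map (cmConjRingHom L))ᵀ * H * (g : Matrix (Fin 3) (Fin 3) L) = Matrix.diagonal dV)
    (ιV : finAdelic (↥(maximalRealSubfield L)) L (IsCMField.complexConj L) 3 H →*
    finAdelic (↥(maximalRealSubfield L)) L (IsCMField.complexConj L) 3 (Matrix.diagonal dV)),
    (∀ k, ((ιV k : finAdelic (↥(maximalRealSubfield L)) L (IsCMField.complexConj L) 3 (Matrix.diagonal dV)) :
    GL (Fin 3) (FiniteAdeleRing (𝓞 L) L)) =
    (toFinAdeleGL L 3 g)⁻¹ * (k : GL (Fin 3) (FiniteAdeleRing (𝓞 L) L)) * toFinAdeleGL L 3 g) →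
    ∀ (μA : Measure (adelicGroupData (↥(maximalRealSubfield L)) L (IsCMField.complexConj L) 3 H).automorphicQuotient)
    [(adelicGroupData (↥(maximalRealSubfield L)) L (IsCMField.complexConj L) 3 H).IsAutomorphicMeasure μA],
    ∀ (μ : Literature.NumberTheory.Automorphic.IdeleClassGroup L →ₜ* Circle) (hμ : IsConjugateSymplectic L μ), HasWeight L μ 1 →
    ∀ (a : (↥(maximalRealSubfield L))ˣ) (χ : Chi (↥(maximalRealSubfield L)) L (IsCMField.complexConj L)),
    (∃ e : L, IsAdmissibleElement L hμ.cmType.1 e ∧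
    epsOf (↥(maximalRealSubfield L)) (imagUnitSq L) L (2 * imagUnit L)⁻¹ e = locF (↥(maximalRealSubfield L)) (imagUnitSq L) a) →
    ∃ (P : DiscreteAutomorphicRep (adelicGroupData (↥(maximalRealSubfield L)) L (IsCMField.complexConj L) 3 H) μA),
    (P.IsHolCotangentAt (cmArchSection L ι H T hT) (cmCompactFactor L ι H T hT) ∨ P.IsAntiholCotangentAt (cmArchSection L ι H T hT) (cmCompactFactor L ι H T hT)) ∧
    P.HasFinComponent
    (rhoAtLine (↥(maximalRealSubfield L)) L (IsCMField.complexConj L) 3 e₁ (Matrix.diagonal dV)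
    (complexConj_imagUnit L) (imagUnit_ne_zero L) (imagUnit_mul_self L) (realDiagonal_isSymm L dV hdV)
    (isUnit_det_realDiagonal L dV hdV hdV0) (realDiagonal_map L dV hdV).symm
    (fun a => isCompatible_chiSplittingLine L e₁ dV hdV hdV0 (toHeckeCharacter L μ)
    (isUnitary_toHeckeCharacter L μ) ((isOscillatorChar_toHeckeCharacter_iff μ).mpr hμ)
    (TW (↥(maximalRealSubfield L)) a) (isSymm_TW (↥(maximalRealSubfield L)) a)
    (isUnit_det_TW (↥(maximalRealSubfield L)) a) (JW (↥(maximalRealSubfield L)) L a)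
    (JW_eq (↥(maximalRealSubfield L)) L a)) ιV a χ) := by
  intro L _ _ _ ι H T hT hpos h2 n' e₁ dV hdV hdV0 g hg ιV hιV μA _ μ hμ hw a χ hadm
  obtain ⟨θ, hθ0, hθA, hθσ⟩ := hΘ L ι H T hT hpos h2 e₁ dV hdV hdV0 g hg ιV hιV μ hμ hw a χ hadm
  have hirr := F0P2cStubCI.rhoAtLine_chi_isIrreducible L H e₁ dV hdV hdV0 g hg ιV hιV μ hμ a χ
  exact exists_cotangentType_hasFinComponent_of_occursIn_cm L ι H T hT hpos h2 μA _ hirr θ hθ0 hθA hθσ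

end Summit.HodgeConjecture.HodgeConjecture.Cruxes.H413.F0P2sOccFlatAllOfThetaOccursIn

end
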